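import Literature.Computability.QuantumComplexity.QSimSign
import Literature.Computability.QuantumComplexity.ForrelationThm25Instance
import HarnessLib

/-!
# Aaronson–Ambainis Theorem 25 over the sign basis, without wire bookkeeping

Topic `Literature/Computability/QuantumComplexity`; fifth file of the decomposition of the named
fact `aaronson_ambainis_kForrelation_complete` (`ForrelationComplete.lean`). Source:
S. Aaronson, A. Ambainis, *Forrelation*, SIAM J. Comput. 47 (2018) = arXiv:1411.5729, §6,
Thm. 25 and its proof (pp. 26–27).

The reduction QSIM `→` explicit `k`-fold FORRELATION of `ForrelationThm25Amplitude.lean` /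
`ForrelationThm25Instance.lean` follows the printed proof: one CSIGN gadget
`H^{⊗2} C H^{⊗2} C H^{⊗2} C H^{⊗2} = SWAP · H^{⊗2}` (p. 27) per Hadamard gate, "keeping track of
[the swap] by swapping the labels" — a bijection between logical qubits and physical wires that
changes after every Hadamard gate. For the polynomial-time machine computing the instance map
(the residual named fact of this decomposition) that bookkeeping is the only non-streaming part:
it needs a table of wire positions with random access. This file removes it. With **two** fixed
dummy wires `d₁, d₂` and three gadgets per Hadamard gate,

  `G(a, d₂) · G(d₁, d₂) · G(a, d₁) = H_a ⊗ D`,  `D := SWAP_{d₁d₂} · H_{d₂}`,  `D² = H ⊗ H`, `D⁴ = 1`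

(`triple_gadget_eq`, `dMat_mul_dMat`, `dMat_pow_four`): the logical qubit stays on its wire, and
all the Hadamards deposited on the dummies are accounted for by the power `D^h` (`h` the number of
Hadamard gates), whose `⟨00|·|00⟩` entry is `1` when `4 ∣ h` and is repaired by one more gadget
`G(d₁, d₂) = SWAP · H^{⊗2}` when `h ≡ 2 (mod 4)`; an odd `h` forces, as in the amplitude file
(every amplitude of a Hadamard/sign circuit lies in `2^{-h/2}ℤ`), one bare layer `H^{⊗N}` undone
on the `n` logical wires by `n` more triples (exponent `h + n + 2`), on `n` odd (an idle logical
wire is added when `n` is even — in both parity cases, so that the layout does not depend on the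
gates). So the instance map becomes a one-pass, syntax-directed
transcription of the gate list in which every wire index is copied verbatim (the subject of the
sequel `TM2` file), over the sign basis `{H, Z, CZ, CCZ}` of `QSimSign.lean`, every `Z`/`CZ`/`CCZ`
gate being one phase function "`(-1)^{C}`, `C` a product of at most `3` input bits" (Thm. 25).

## Contents

* `permGate`, `permGate_mul_placeGate` (wire permutations conjugate placed gates),
  `placeGate_pairEmb_swapLayer`; `hadamardAt w` (one Hadamard gate on wire `w`);
* `dMat`, `dMat_mul_dMat`, `dMat_pow_four`, `gadget_eq_permGate`, **`triple_gadget_eq`**;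
* `SignShape N` (`none | one a | two a b | three a b c`), `toFun`, `toCircuit` (`≤ 2` binary AND
  gates, over `B₂`), the blocks `gadgetS`, `tripleS`, `blockS`, the translation `coreS`/`buildS`
  of a gate list and **`forrelationCircuitL_buildS`**:
  `F(buildS gs) = (U_{gs} on the logical wires) · (D^{h} on the dummies)`;
  the finishing step `finishS` (pair gadget iff the exponent is `2 mod 4`) and the odd case
  `oddS` (bare layer + un-Hadamard triples), with `⟨0|F|0⟩ = A_Q` in all cases
  (`apply_zero_zero_finishS_buildS`, `apply_zero_zero_finishS_oddS`);
* `thm25SignShapes`, `thm25SignInstance : QSimSignInstance → KForrelationInstance`,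
  **`value_thm25SignInstance : Φ = A_Q`**, `isYes_thm25SignInstance`, `isNo_thm25SignInstance`,
  the bounds `N ≤ n + 3`, `k ≤ 12(m + n + 1) + 8`, `≤ 2` gates per circuit;
* the residual named fact `AaronsonAmbainis2018_thm25_sign_encodeFP` (the code map is in `FP`)
  with `AaronsonAmbainis2018_thm25_sign_of_encodeFP` and
  `aaronson_ambainis_kForrelation_complete_of_sign_encodeFP`.

## References

* S. Aaronson, A. Ambainis, *Forrelation: a problem that optimally separates quantum from
  classical computing*, SIAM J. Comput. 47 (2018) 982–1038; arXiv:1411.5729, §6, Thm. 25 and its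
  proof (pp. 26–27: the CSIGN gadget, "C is a product of at most 3 input bits", `k = O(m)`).
* M. A. Nielsen, I. L. Chuang, *Quantum Computation and Quantum Information*, CUP 2010, §4.2
  (placement of gates), §1.3.4 (SWAP), §1.4.4 (`H^{⊗n}`).
-/

noncomputable section

namespace Literature.Computability.QuantumComplexity

open Matrix _root_.Computability Complexity Cryptography Finset

variable {N n k : ℕ}

/-! ### Wire permutations -/

/-- The permutation of the wires of an `N`-qubit register by `π`: `|y⟩ ↦ |y ∘ π⁻¹⟩`, i.e. the
`(x, y)` entry is `[y = x ∘ π]`. [cite: NielsenChuang2010, §1.3.4 (SWAP)] -/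
def permGate (π : Equiv.Perm (Fin N)) : Matrix (QReg N) (QReg N) ℂ :=
  Matrix.of fun x y => if y = x ∘ π then 1 else 0

/-- Entries of a wire permutation (definitional). [folklore] -/
theorem permGate_apply (π : Equiv.Perm (Fin N)) (x y : QReg N) :
    permGate π x y = if y = x ∘ π then 1 else 0 := rfl

/-- Left multiplication by a wire permutation reindexes the row: `(P_π M)(x, y) = M(x ∘ π, y)`.
[folklore] -/
theorem permGate_mul_apply (π : Equiv.Perm (Fin N)) (M : Matrix (QReg N) (QReg N) ℂ) (x y : QReg N) :
    (permGate π * M) x y = M (x ∘ π) y := by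
  rw [Matrix.mul_apply, Finset.sum_eq_single (x ∘ π)]
  · simp [permGate_apply]
  · intro z _ hz
    simp [permGate_apply, hz]
  · intro h
    exact absurd (Finset.mem_univ _) h

/-- Right multiplication by a wire permutation reindexes the column:
`(M P_π)(x, y) = M(x, y ∘ π⁻¹)`. [folklore] -/
theorem mul_permGate_apply (M : Matrix (QReg N) (QReg N) ℂ) (π : Equiv.Perm (Fin N)) (x y : QReg N) :
    (M * permGate π) x y = M x (y ∘ π.symm) := by
  rw [Matrix.mul_apply, Finset.sum_eq_single (y ∘ π.symm)]
  · rw [permGate_apply, if_pos, mul_one]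
    funext i
    simp
  · intro z _ hz
    rw [permGate_apply, if_neg, mul_zero]
    rintro rfl
    apply hz
    funext i
    simp
  · intro h
    exact absurd (Finset.mem_univ _) h

/-- The identity permutation is the identity. [folklore] -/
@[simp] theorem permGate_refl : permGate (Equiv.refl (Fin N)) = 1 := by
  ext x y
  simp only [permGate_apply, Equiv.coe_refl, Function.comp_id, Matrix.one_apply]
  by_cases h : x = y
  · simp [h]
  · rw [if_neg (Ne.symm h), if_neg h]

/-- Wire permutations compose: `P_π P_ρ = P_{ρ ≫ π}` (apply `ρ` first on wire labels of the
function argument). [folklore] -/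
theorem permGate_mul_permGate (π ρ : Equiv.Perm (Fin N)) :
    permGate π * permGate ρ = permGate (ρ.trans π) := by
  ext x y
  rw [permGate_mul_apply, permGate_apply, permGate_apply]
  rfl

/-- **Wire permutations conjugate placed gates**: `P_π · U_e = U_{π ∘ e} · P_π`.
[cite: NielsenChuang2010, §4.2] -/
theorem permGate_mul_placeGate (π : Equiv.Perm (Fin N)) (e : Fin k ↪ Fin N)
    (U : Matrix (QReg k) (QReg k) ℂ) :
    permGate π * placeGate e U = placeGate (e.trans π.toEmbedding) U * permGate π := by
  ext x y
  rw [permGate_mul_apply, mul_permGate_apply, placeGate_apply, placeGate_apply]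
  have h1 : (x ∘ (e.trans π.toEmbedding)) = (x ∘ π) ∘ e := rfl
  have h2 : ((y ∘ π.symm) ∘ (e.trans π.toEmbedding)) = y ∘ e := by
    funext j
    simp
  have hc : (∀ i, i ∉ Set.range (e.trans π.toEmbedding) → x i = (y ∘ π.symm) i) ↔
      (∀ i, i ∉ Set.range e → (x ∘ π) i = y i) := by
    constructor
    · intro h i hi
      have := h (π i) (fun ⟨j, hj⟩ => hi ⟨j, π.injective (by simpa using hj)⟩)
      simpa using this
    · intro h i hi
      have := h (π.symm i) (fun ⟨j, hj⟩ => hi ⟨j, by simpa using congrArg π hj⟩)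
      simpa using this
  rw [h1, h2]
  by_cases h : ∀ i, i ∉ Set.range e → (x ∘ π) i = y i
  · rw [if_pos h, if_pos (hc.2 h)]
  · rw [if_neg h, if_neg fun h' => h (hc.1 h')]

/-- The placed two-qubit SWAP is the transposition of its two wires.
[cite: NielsenChuang2010, §1.3.4] -/
theorem placeGate_pairEmb_swapLayer (p q : Fin N) (h : p ≠ q) :
    placeGate (pairEmb p q h) swapLayer = permGate (Equiv.swap p q) := by
  ext x y
  rw [placeGate_apply, permGate_apply]
  simp only [swapLayer, Matrix.of_apply, Function.comp_apply, pairEmb_zero, pairEmb_one]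
  by_cases hy : y = x ∘ Equiv.swap p q
  · subst hy
    rw [if_pos, if_pos, if_pos rfl]
    · simp [Equiv.swap_apply_left, Equiv.swap_apply_right]
    · intro i hi
      rw [mem_range_pairEmb_iff] at hi
      push Not at hi
      simp [Equiv.swap_apply_of_ne_of_ne hi.1 hi.2]
  · rw [if_neg hy]
    split_ifs with h1 h2
    · exfalso
      apply hy
      funext i
      by_cases hip : i = p
      · subst hip
        simp [h2.2]
      · by_cases hiq : i = q
        · subst hiq
          simp [h2.1]
        · rw [Function.comp_apply, Equiv.swap_apply_of_ne_of_ne hip hiq]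
          exact (h1 i (by rw [mem_range_pairEmb_iff]; tauto)).symm
    · rfl
    · rfl

/-! ### One Hadamard gate on a wire -/

/-- One Hadamard gate on the wire `w` of an `N`-qubit register. [cite: NielsenChuang2010, §4.2] -/
abbrev hadamardAt (w : Fin N) : Matrix (QReg N) (QReg N) ℂ :=
  placeGate (wireEmb w) hGate

/-- A one-wire embedding followed by an embedding is the one-wire embedding of the image. [folklore] -/
theorem wireEmb_trans {M : ℕ} (e : Fin N ↪ Fin M) (w : Fin N) : (wireEmb w).trans e = wireEmb (e w) := by
  ext j
  simp

/-- Placing a one-wire Hadamard along an embedding. [cite: NielsenChuang2010, §4.2] -/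
theorem placeGate_hadamardAt {M : ℕ} (e : Fin N ↪ Fin M) (w : Fin N) :
    placeGate e (hadamardAt w) = hadamardAt (e w) := by
  rw [hadamardAt, placeGate_placeGate, wireEmb_trans]

/-- `H_w H_w = 1`. [cite: NielsenChuang2010, §2.1.8] -/
theorem hadamardAt_mul_hadamardAt_self (w : Fin N) : hadamardAt w * hadamardAt w = 1 := by
  rw [hadamardAt, ← placeGate_mul_holds, hGate_mul_hGate, placeGate_one]

/-- … in the form `H_w (H_w X) = X`. [cite: NielsenChuang2010, §2.1.8] -/
theorem hadamardAt_mul_hadamardAt_mul (w : Fin N) (X : Matrix (QReg N) (QReg N) ℂ) :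
    hadamardAt w * (hadamardAt w * X) = X := by
  rw [← mul_assoc, hadamardAt_mul_hadamardAt_self, one_mul]

/-- Hadamard gates on distinct wires commute. [cite: NielsenChuang2010, §4.2] -/
theorem hadamardAt_comm {v w : Fin N} (h : v ≠ w) : hadamardAt v * hadamardAt w = hadamardAt w * hadamardAt v :=
  placeGate_comm_of_disjoint_holds _ _ (by rw [range_wireEmb, range_wireEmb]; simpa using h) _ _

/-- … in the form `H_v (H_w X) = H_w (H_v X)`. [cite: NielsenChuang2010, §4.2] -/
theorem hadamardAt_comm_mul {v w : Fin N} (h : v ≠ w) (X : Matrix (QReg N) (QReg N) ℂ) :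
    hadamardAt v * (hadamardAt w * X) = hadamardAt w * (hadamardAt v * X) := by
  rw [← mul_assoc, hadamardAt_comm h, mul_assoc]

/-- A Hadamard gate commutes with a gate placed on wires not containing it. [cite: NielsenChuang2010, §4.2] -/
theorem hadamardAt_mul_placeGate_comm {w : Fin N} {e : Fin k ↪ Fin N} (hw : w ∉ Set.range e)
    (U : Matrix (QReg k) (QReg k) ℂ) : hadamardAt w * placeGate e U = placeGate e U * hadamardAt w :=
  placeGate_comm_of_disjoint_holds _ _ (by rw [range_wireEmb]; simpa using hw) _ _

/-- Moving a Hadamard gate through a wire permutation: `H_w P_π = P_π H_{π⁻¹ w}`.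
[cite: NielsenChuang2010, §4.2] -/
theorem hadamardAt_mul_permGate (w : Fin N) (π : Equiv.Perm (Fin N)) :
    hadamardAt w * permGate π = permGate π * hadamardAt (π.symm w) := by
  rw [hadamardAt, hadamardAt, permGate_mul_placeGate, wireEmb_trans]
  simp

/-- … in the form `H_w (P_π X) = P_π (H_{π⁻¹ w} X)`. [cite: NielsenChuang2010, §4.2] -/
theorem hadamardAt_mul_permGate_mul (w : Fin N) (π : Equiv.Perm (Fin N)) (X : Matrix (QReg N) (QReg N) ℂ) :
    hadamardAt w * (permGate π * X) = permGate π * (hadamardAt (π.symm w) * X) := by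
  rw [← mul_assoc, hadamardAt_mul_permGate, mul_assoc]

/-- `H^{⊗2} = H₀ H₁` on a two-qubit register. [cite: NielsenChuang2010, §1.4.4] -/
theorem hGateAll_two_eq_hadamardAt_mul : hGateAll 2 = hadamardAt (0 : Fin 2) * hadamardAt 1 := by
  ext x y
  rw [hGateAll_apply_eq_prod, Fin.prod_univ_two, hadamardAt, hadamardAt,
    placeGate_mul_placeGate_apply_of_disjoint _ _ (by rw [range_wireEmb, range_wireEmb]; simp)]
  rw [if_pos]
  · simp [hGate_apply_eq_hadamardEntry]
  · intro i hi0 hi1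
    rw [range_wireEmb] at hi0 hi1
    fin_cases i <;> simp at hi0 hi1

/-! ### The dummy-pair operator `D` and the triple of gadgets -/

/-- The operator `D := SWAP · H₁` on the two dummy wires (first a Hadamard on the second dummy,
then the swap): the net effect of one triple of gadgets on the dummies.
[cite: AaronsonAmbainis2018, §6 (proof of Thm. 25, the gadget)] -/
def dMat : Matrix (QReg 2) (QReg 2) ℂ :=
  swapLayer * hadamardAt 1

/-- The two-qubit SWAP is the transposition of the two wires. [cite: NielsenChuang2010, §1.3.4] -/
theorem swapLayer_eq_permGate : swapLayer = permGate (Equiv.swap (0 : Fin 2) 1) := by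
  have h := placeGate_pairEmb_swapLayer (0 : Fin 2) 1 (by decide)
  have he : pairEmb (0 : Fin 2) 1 (by decide) = (Equiv.refl (Fin 2)).toEmbedding := by
    ext j
    fin_cases j <;> rfl
  rw [he] at h
  rw [← h]
  ext x y
  rw [placeGate_apply, if_pos]
  · rfl
  · intro i hi
    exact absurd ⟨i, rfl⟩ hi

/-- A transposition is an involution. [folklore] -/
theorem swap_trans_swap {α : Type*} [DecidableEq α] (a b : α) :
    (Equiv.swap a b).trans (Equiv.swap a b) = Equiv.refl α :=
  Equiv.ext fun i => by simp

/-- `SWAP² = 1`. [cite: NielsenChuang2010, §1.3.4] -/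
theorem swapLayer_mul_swapLayer : swapLayer * swapLayer = 1 := by
  rw [swapLayer_eq_permGate, permGate_mul_permGate, swap_trans_swap, permGate_refl]

/-- **`D² = H ⊗ H`**: `SWAP H₁ SWAP H₁ = H₀ H₁`. [cite: AaronsonAmbainis2018, §6 (proof of Thm. 25)] -/
theorem dMat_mul_dMat : dMat * dMat = hGateAll 2 := by
  rw [dMat, swapLayer_eq_permGate, mul_assoc, hadamardAt_mul_permGate_mul, ← mul_assoc, ← mul_assoc,
    permGate_mul_permGate, swap_trans_swap, permGate_refl, one_mul, hGateAll_two_eq_hadamardAt_mul]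
  rfl

/-- **`D⁴ = 1`.** [cite: AaronsonAmbainis2018, §6 (proof of Thm. 25)] -/
theorem dMat_pow_four : dMat ^ 4 = 1 := by
  rw [show 4 = 2 + 2 from rfl, pow_add, pow_two, dMat_mul_dMat, hGateAll_mul_self]

/-- `D^j = D^{j mod 4}`. [folklore] -/
theorem dMat_pow_eq_pow_mod (j : ℕ) : dMat ^ j = dMat ^ (j % 4) := by
  conv_lhs => rw [← Nat.div_add_mod j 4, pow_add, pow_mul, dMat_pow_four, one_pow, one_mul]

/-- `⟨00| SWAP |00⟩ = 1`. [cite: NielsenChuang2010, §1.3.4] -/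
theorem swapLayer_apply_zero_zero : swapLayer (fun _ => false) (fun _ => false) = 1 := by
  simp [swapLayer]

/-- `⟨00| D^j |00⟩ = 1` when `4 ∣ j`. [cite: AaronsonAmbainis2018, §6 (proof of Thm. 25)] -/
theorem dMat_pow_apply_zero_zero {j : ℕ} (hj : j % 4 = 0) :
    (dMat ^ j) (fun _ => false) (fun _ => false) = 1 := by
  rw [dMat_pow_eq_pow_mod, hj, pow_zero, Matrix.one_apply_eq]

/-- The pair gadget repairs the exponent `2 mod 4`: `SWAP H^{⊗2} D^j = SWAP` when `j ≡ 2 (mod 4)`,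
whose `⟨00|·|00⟩` entry is `1`. [cite: AaronsonAmbainis2018, §6 (proof of Thm. 25)] -/
theorem swapLayer_mul_hGateAll_mul_dMat_pow {j : ℕ} (hj : j % 4 = 2) :
    swapLayer * hGateAll 2 * dMat ^ j = swapLayer := by
  rw [dMat_pow_eq_pow_mod, hj, pow_two, dMat_mul_dMat, mul_assoc, hGateAll_mul_self, mul_one]

/-- **The gadget is a transposition followed by two Hadamards**:
`G(p, q) = SWAP_{pq} H_p H_q = P_{(p q)} · H_p · H_q` on `N` wires.
[cite: AaronsonAmbainis2018, §6 (proof of Thm. 25, p. 27)] -/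
theorem gadget_eq_permGate (p q : Fin N) (h : p ≠ q) :
    placeGate (pairEmb p q h) (swapLayer * hGateAll 2) =
      permGate (Equiv.swap p q) * (hadamardAt p * hadamardAt q) := by
  rw [placeGate_mul_holds, placeGate_pairEmb_swapLayer, hGateAll_two_eq_hadamardAt_mul, placeGate_mul_holds,
    placeGate_hadamardAt, placeGate_hadamardAt, pairEmb_zero, pairEmb_one]

/-- The composite of the three transpositions `(a d₁)`, then `(d₁ d₂)`, then `(a d₂)` is the
transposition `(d₁ d₂)`. [folklore] -/
theorem swap_trans_swap_trans_swap {a d₁ d₂ : Fin N} (h₁ : a ≠ d₁) (h₂ : a ≠ d₂) (h₁₂ : d₁ ≠ d₂) :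
    (Equiv.swap a d₁).trans ((Equiv.swap d₁ d₂).trans (Equiv.swap a d₂)) = Equiv.swap d₁ d₂ := by
  refine Equiv.ext fun i => ?_
  simp only [Equiv.trans_apply]
  rcases eq_or_ne i a with rfl | hia
  · rw [Equiv.swap_apply_left, Equiv.swap_apply_left, Equiv.swap_apply_right,
      Equiv.swap_apply_of_ne_of_ne h₁ h₂]
  rcases eq_or_ne i d₁ with rfl | hi1
  · rw [Equiv.swap_apply_right, Equiv.swap_apply_of_ne_of_ne h₁ h₂, Equiv.swap_apply_left,
      Equiv.swap_apply_left]
  rcases eq_or_ne i d₂ with rfl | hi2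
  · rw [Equiv.swap_apply_of_ne_of_ne hia hi1, Equiv.swap_apply_right, Equiv.swap_apply_of_ne_of_ne h₁.symm h₁₂]
  · rw [Equiv.swap_apply_of_ne_of_ne hia hi1, Equiv.swap_apply_of_ne_of_ne hi1 hi2,
      Equiv.swap_apply_of_ne_of_ne hia hi2]

/-- **The triple of gadgets.** On `N` wires with pairwise distinct `a, d₁, d₂`:
`G(a, d₂) · G(d₁, d₂) · G(a, d₁) = H_a · D_{d₁d₂}` — one Hadamard gate on `a`, the wire `a`
keeping its place, and the operator `D = SWAP · H_{d₂}` on the two dummies. (Push the three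
transpositions to the left through the Hadamards, `H_w P_π = P_π H_{π⁻¹w}`, cancel `H_{d₁}²` twice,
and compose the transpositions to `(d₁ d₂)`.) [cite: AaronsonAmbainis2018, §6 (proof of Thm. 25, the gadget)] -/
theorem triple_gadget_eq {a d₁ d₂ : Fin N} (h₁ : a ≠ d₁) (h₂ : a ≠ d₂) (h₁₂ : d₁ ≠ d₂) :
    placeGate (pairEmb a d₂ h₂) (swapLayer * hGateAll 2) *
        (placeGate (pairEmb d₁ d₂ h₁₂) (swapLayer * hGateAll 2) *
          placeGate (pairEmb a d₁ h₁) (swapLayer * hGateAll 2)) =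
      hadamardAt a * placeGate (pairEmb d₁ d₂ h₁₂) dMat := by
  rw [gadget_eq_permGate, gadget_eq_permGate, gadget_eq_permGate]
  simp only [mul_assoc]
  -- `P₃ (H_a (H_{d₂} (P₂ (H_{d₁} (H_{d₂} (P₁ (H_a H_{d₁})))))))`: move `P₂` left, cancel `H_{d₁}²`
  rw [hadamardAt_mul_permGate_mul d₂ (Equiv.swap d₁ d₂), Equiv.symm_swap, Equiv.swap_apply_right,
    hadamardAt_mul_permGate_mul a (Equiv.swap d₁ d₂), Equiv.symm_swap, Equiv.swap_apply_of_ne_of_ne h₁ h₂,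
    hadamardAt_mul_hadamardAt_mul]
  -- `P₃ (P₂ (H_a (H_{d₂} (P₁ (H_a H_{d₁})))))`: move `P₁` left
  rw [hadamardAt_mul_permGate_mul d₂ (Equiv.swap a d₁), Equiv.symm_swap,
    Equiv.swap_apply_of_ne_of_ne h₂.symm h₁₂.symm,
    hadamardAt_mul_permGate_mul a (Equiv.swap a d₁), Equiv.symm_swap, Equiv.swap_apply_left]
  -- `P₃ (P₂ (P₁ (H_{d₁} (H_{d₂} (H_a H_{d₁})))))`: cancel `H_{d₁}²`
  rw [hadamardAt_comm_mul h₁₂, hadamardAt_comm_mul h₁.symm (hadamardAt d₁), hadamardAt_mul_hadamardAt_self,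
    mul_one]
  -- `P₃ P₂ P₁ (H_{d₂} H_a)`: compose the transpositions and reassemble `D`
  rw [← mul_assoc, ← mul_assoc, permGate_mul_permGate, permGate_mul_permGate,
    swap_trans_swap_trans_swap h₁ h₂ h₁₂, ← placeGate_pairEmb_swapLayer d₁ d₂ h₁₂, hadamardAt_comm h₂.symm,
    ← mul_assoc, ← hadamardAt_mul_placeGate_comm (e := pairEmb d₁ d₂ h₁₂)
      (by rw [mem_range_pairEmb_iff]; push Not; exact ⟨h₁, h₂⟩) swapLayer,
    mul_assoc, dMat, placeGate_mul_holds, placeGate_hadamardAt, pairEmb_one]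

/-! ### The shapes of the produced functions and their circuits -/

/-- The shapes of the functions `fᵢ = (-1)^{C}` produced by the reduction over the sign basis:
`C = 0`, `C = z_a`, `C = z_a z_b` or `C = z_a z_b z_c` (the one-bit shape, absent from `FewBits` of
`ForrelationThm25Instance.lean`, is the phase of a `Z` gate).
[cite: AaronsonAmbainis2018, §6 Thm. 25 ("C is a product of at most 3 input bits")] -/
inductive SignShape (N : ℕ)
  /-- `C = 0`, i.e. `f = 1`. -/
  | none
  /-- `C = z_a`. -/
  | one (a : Fin N)
  /-- `C = z_a z_b`. -/
  | two (a b : Fin N)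
  /-- `C = z_a z_b z_c`. -/
  | three (a b c : Fin N)

namespace SignShape

/-- The Boolean function `C` of a shape (`f = (-1)^C` through `signOf`).
[cite: AaronsonAmbainis2018, §6 Thm. 25] -/
def toFun : SignShape N → (Fin N → Bool) → Bool
  | none => fun _ => false
  | one a => fun z => z a
  | two a b => csignFun a b
  | three a b c => fun z => z a && (z b && z c)

/-- The `B₂`-circuit of a shape: the constant circuit, an input wire, one AND gate, or two AND
gates (`FewBits.and2Circuit`, `FewBits.and3Circuit`). [cite: AaronsonAmbainis2018, §6 Thm. 25 ("easy to specify using a Boolean circuit")] -/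
def toCircuit : SignShape N → Circuit (Fin N)
  | none => Circuit.const (Fin N) false
  | one a => Circuit.input a
  | two a b => FewBits.and2Circuit a b
  | three a b c => FewBits.and3Circuit a b c

/-- The circuit of a shape computes its Boolean function. [cite: AaronsonAmbainis2018, §6 Thm. 25] -/
theorem eval_toCircuit (s : SignShape N) (x : Fin N → Bool) : s.toCircuit.eval x = s.toFun x := by
  cases s <;> rfl

/-- As functions: the circuit of a shape computes its Boolean function. [cite: AaronsonAmbainis2018, §6 Thm. 25] -/
theorem eval_toCircuit_eq (s : SignShape N) : s.toCircuit.eval = s.toFun :=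
  funext (eval_toCircuit s)

/-- The circuits of the shapes are over `B₂`. [cite: AaronsonAmbainis2018, §6 Thm. 25] -/
theorem toCircuit_isOver_B2 (s : SignShape N) : s.toCircuit.IsOver B2 := by
  cases s with
  | none => exact FewBits.toCircuit_isOver_B2 .one
  | one a => intro g hg; simp [toCircuit, Circuit.input] at hg
  | two a b => exact FewBits.toCircuit_isOver_B2 (.two a b)
  | three a b c => exact FewBits.toCircuit_isOver_B2 (.three a b c)

/-- The circuits of the shapes have at most two gates. [cite: AaronsonAmbainis2018, §6 Thm. 25] -/
theorem size_toCircuit_le (s : SignShape N) : s.toCircuit.size ≤ 2 := by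
  cases s with
  | none => exact FewBits.size_toCircuit_le .one
  | one a => simp [toCircuit]
  | two a b => exact FewBits.size_toCircuit_le (.two a b)
  | three a b c => exact FewBits.size_toCircuit_le (.three a b c)

/-- Every shape is a few-bit product (`IsFewBitProduct`). [cite: AaronsonAmbainis2018, §6 Thm. 25] -/
theorem isFewBitProduct_toFun (s : SignShape N) : IsFewBitProduct s.toFun := by
  cases s with
  | none => exact isFewBitProduct_const_false N
  | one a => exact ⟨{a}, by simp, fun z => by simp [toFun]⟩
  | two a b => exact FewBits.isFewBitProduct_toFun (.two a b)
  | three a b c => exact FewBits.isFewBitProduct_toFun (.three a b c)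

/-- The separating constant function `1`. [cite: AaronsonAmbainis2018, §6 (p. 26)] -/
@[simp] theorem toFun_none : (none : SignShape N).toFun = fun _ => false := rfl

end SignShape

/-- The Fig. 2 circuit of a list of shapes. [cite: AaronsonAmbainis2018, §3.2 and §6] -/
abbrev shapeCircuit (L : List (SignShape N)) : Matrix (QReg N) (QReg N) ℂ :=
  forrelationCircuitL (L.map SignShape.toFun)

/-- Composition law for shape lists: a separating `none` multiplies the circuits.
[cite: AaronsonAmbainis2018, §6 (p. 26)] -/
theorem shapeCircuit_append_sep (A B : List (SignShape N)) :
    shapeCircuit (A ++ .none :: B) = shapeCircuit B * shapeCircuit A := by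
  rw [shapeCircuit, List.map_append, List.map_cons, SignShape.toFun_none, forrelationCircuitL_append_sep]

/-- `F([none]) = 1`. [cite: AaronsonAmbainis2018, §6 (p. 26)] -/
@[simp] theorem shapeCircuit_sep : shapeCircuit [(.none : SignShape N)] = 1 := by
  rw [shapeCircuit, List.map_cons, List.map_nil, SignShape.toFun_none, forrelationCircuitL_sep]

/-- `F([]) = H^{⊗N}` (a bare layer). [cite: AaronsonAmbainis2018, §3.2] -/
@[simp] theorem shapeCircuit_nil : shapeCircuit ([] : List (SignShape N)) = hGateAll N := rfl

/-- `F(none :: L) = F(L) · H^{⊗N}`. [cite: AaronsonAmbainis2018, §3.2] -/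
theorem shapeCircuit_sep_cons (L : List (SignShape N)) :
    shapeCircuit (.none :: L) = shapeCircuit L * hGateAll N := by
  rw [shapeCircuit, List.map_cons, SignShape.toFun_none, forrelationCircuitL, phaseLayer_const_false, mul_one]

/-- The phase block `[none, s, none]` is the phase layer `U_s`. [cite: AaronsonAmbainis2018, §6 (proof of Thm. 25)] -/
theorem shapeCircuit_phase_block (s : SignShape N) :
    shapeCircuit [.none, s, .none] = phaseLayer s.toFun := by
  rw [shapeCircuit, List.map_cons, List.map_cons, List.map_cons, List.map_nil, SignShape.toFun_none,
    forrelationCircuitL_phase_block]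

/-! ### The blocks -/

/-- The CSIGN gadget `[C, C, C]`, `C = (-1)^{z_p z_q}`. [cite: AaronsonAmbainis2018, §6 (proof of Thm. 25, p. 27)] -/
def gadgetS (p q : Fin N) : List (SignShape N) :=
  [.two p q, .two p q, .two p q]

/-- The gadget block is `SWAP · H^{⊗2}` on its two wires. [cite: AaronsonAmbainis2018, §6 (proof of Thm. 25, p. 27)] -/
theorem shapeCircuit_gadgetS (p q : Fin N) (h : p ≠ q) :
    shapeCircuit (gadgetS p q) = placeGate (pairEmb p q h) (swapLayer * hGateAll 2) := by
  rw [shapeCircuit, gadgetS, List.map_cons, List.map_cons, List.map_cons, List.map_nil]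
  exact (forrelationCircuitL_triple _).trans (gadget_eq_placeGate p q h)

/-- **The triple of gadgets** simulating one Hadamard gate on `a` with the dummies `d₁, d₂`:
`G(a, d₁), 1, G(d₁, d₂), 1, G(a, d₂)` (eleven functions).
[cite: AaronsonAmbainis2018, §6 (proof of Thm. 25, the gadget)] -/
def tripleS (a d₁ d₂ : Fin N) : List (SignShape N) :=
  gadgetS a d₁ ++ .none :: (gadgetS d₁ d₂ ++ .none :: gadgetS a d₂)

/-- The triple has eleven functions. [folklore] -/
@[simp] theorem length_tripleS (a d₁ d₂ : Fin N) : (tripleS a d₁ d₂).length = 11 := rfl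

/-- **The triple block is `H_a · D_{d₁d₂}`.** [cite: AaronsonAmbainis2018, §6 (proof of Thm. 25, the gadget)] -/
theorem shapeCircuit_tripleS {a d₁ d₂ : Fin N} (h₁ : a ≠ d₁) (h₂ : a ≠ d₂) (h₁₂ : d₁ ≠ d₂) :
    shapeCircuit (tripleS a d₁ d₂) = hadamardAt a * placeGate (pairEmb d₁ d₂ h₁₂) dMat := by
  rw [tripleS, shapeCircuit_append_sep, shapeCircuit_append_sep, shapeCircuit_gadgetS _ _ h₂,
    shapeCircuit_gadgetS _ _ h₁₂, shapeCircuit_gadgetS _ _ h₁, mul_assoc, triple_gadget_eq h₁ h₂ h₁₂]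

/-! ### The layout: `n` logical wires followed by the two dummies -/

/-- The logical wire `a < n` of the `(n + 2)`-wire register. [cite: AaronsonAmbainis2018, §6 (proof of Thm. 25)] -/
def realEmb (n : ℕ) : Fin n ↪ Fin (n + 2) := Fin.castAddEmb 2

/-- The first dummy wire `n`. [cite: AaronsonAmbainis2018, §6 (proof of Thm. 25)] -/
def dum₁ (n : ℕ) : Fin (n + 2) := ⟨n, by omega⟩

/-- The second dummy wire `n + 1`. [cite: AaronsonAmbainis2018, §6 (proof of Thm. 25)] -/
def dum₂ (n : ℕ) : Fin (n + 2) := ⟨n + 1, by omega⟩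

/-- The value of a logical wire is its index. [folklore] -/
@[simp] theorem realEmb_val (a : Fin n) : (realEmb n a : ℕ) = a := rfl

/-- The value of the first dummy wire is `n`. [folklore] -/
@[simp] theorem dum₁_val : (dum₁ n : ℕ) = n := rfl

/-- The value of the second dummy wire is `n + 1`. [folklore] -/
@[simp] theorem dum₂_val : (dum₂ n : ℕ) = n + 1 := rfl

/-- The dummies are distinct. [folklore] -/
theorem dum₁_ne_dum₂ : dum₁ n ≠ dum₂ n := fun h => by
  have := congrArg Fin.val h; simp at this

/-- A logical wire is not the first dummy. [folklore] -/
theorem realEmb_ne_dum₁ (a : Fin n) : realEmb n a ≠ dum₁ n := fun h => by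
  have := congrArg Fin.val h; simp at this; omega

/-- A logical wire is not the second dummy. [folklore] -/
theorem realEmb_ne_dum₂ (a : Fin n) : realEmb n a ≠ dum₂ n := fun h => by
  have := congrArg Fin.val h; simp at this; omega

/-- The two dummy wires as an embedding. [folklore] -/
def dumEmb (n : ℕ) : Fin 2 ↪ Fin (n + 2) := pairEmb (dum₁ n) (dum₂ n) dum₁_ne_dum₂

/-- The first dummy is not a logical wire. [folklore] -/
theorem dum₁_not_mem_range_realEmb : dum₁ n ∉ Set.range (realEmb n) := by
  rintro ⟨a, ha⟩; exact realEmb_ne_dum₁ a ha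

/-- The second dummy is not a logical wire. [folklore] -/
theorem dum₂_not_mem_range_realEmb : dum₂ n ∉ Set.range (realEmb n) := by
  rintro ⟨a, ha⟩; exact realEmb_ne_dum₂ a ha

/-- A logical wire is not a dummy. [folklore] -/
theorem realEmb_not_mem_range_dumEmb (a : Fin n) : realEmb n a ∉ Set.range (dumEmb n) := by
  rw [dumEmb, mem_range_pairEmb_iff]
  push Not
  exact ⟨realEmb_ne_dum₁ a, realEmb_ne_dum₂ a⟩

/-- The logical wires and the dummies are disjoint. [folklore] -/
theorem disjoint_range_realEmb_dumEmb : Disjoint (Set.range (realEmb n)) (Set.range (dumEmb n)) := by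
  refine Set.disjoint_left.2 ?_
  rintro i ⟨a, rfl⟩
  exact realEmb_not_mem_range_dumEmb a

/-- Every wire is a logical wire or a dummy. [folklore] -/
theorem mem_range_realEmb_or_dumEmb (i : Fin (n + 2)) : i ∈ Set.range (realEmb n) ∨ i ∈ Set.range (dumEmb n) := by
  by_cases hi : (i : ℕ) < n
  · exact Or.inl ⟨⟨i, hi⟩, Fin.ext rfl⟩
  · right
    rw [dumEmb, mem_range_pairEmb_iff]
    have := i.isLt
    rcases Nat.lt_or_ge (i : ℕ) (n + 1) with h | h
    · exact Or.inl (Fin.ext (by simp; omega))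
    · exact Or.inr (Fin.ext (by simp; omega))

/-- A gate placed on logical wires commutes with a gate placed on the dummies. [cite: NielsenChuang2010, §4.2] -/
theorem placeGate_dumEmb_mul_placeGate_realEmb (V : Matrix (QReg 2) (QReg 2) ℂ) (M : Matrix (QReg n) (QReg n) ℂ) :
    placeGate (dumEmb n) V * placeGate (realEmb n) M = placeGate (realEmb n) M * placeGate (dumEmb n) V :=
  (placeGate_comm_of_disjoint_holds _ _ disjoint_range_realEmb_dumEmb M V).symm

/-- `H^{⊗(n+2)} = H^{⊗n} ⊗ H^{⊗2}` along the layout. [cite: NielsenChuang2010, §1.4.4] -/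
theorem hGateAll_layout (n : ℕ) :
    hGateAll (n + 2) = placeGate (realEmb n) (hGateAll n) * placeGate (dumEmb n) (hGateAll 2) := by
  ext x y
  rw [hGateAll_apply_eq_prod, Fin.prod_univ_add, Fin.prod_univ_two,
    placeGate_mul_placeGate_apply_of_disjoint _ _ disjoint_range_realEmb_dumEmb, if_pos, hGateAll_apply_eq_prod,
    hGateAll_apply_eq_prod, Fin.prod_univ_two]
  · rfl
  · intro i h1 h2
    exact ((mem_range_realEmb_or_dumEmb i).elim h1 h2).elim

/-! ### The translation of a gate list -/

/-- The placement of an `H` gate of `hSign`, arity unfolded. [folklore] -/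
abbrev signPlacementH (e : Fin (hSign.arity HSignOp.H) ↪ Fin n) : Fin 1 ↪ Fin n := e
/-- The placement of a `Z` gate of `hSign`, arity unfolded. [folklore] -/
abbrev signPlacementZ (e : Fin (hSign.arity HSignOp.Z) ↪ Fin n) : Fin 1 ↪ Fin n := e
/-- The placement of a `CZ` gate of `hSign`, arity unfolded. [folklore] -/
abbrev signPlacementCZ (e : Fin (hSign.arity HSignOp.CZ) ↪ Fin n) : Fin 2 ↪ Fin n := e
/-- The placement of a `CCZ` gate of `hSign`, arity unfolded. [folklore] -/
abbrev signPlacementCCZ (e : Fin (hSign.arity HSignOp.CCZ) ↪ Fin n) : Fin 3 ↪ Fin n := e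

/-- Matrix of a placed `H` gate of `hSign`. [folklore] -/
theorem toMatrix_sign_H (A : Language Bool) (e : Fin (hSign.arity HSignOp.H) ↪ Fin n) :
    (QGate.gate HSignOp.H e : QGate hSign n).toMatrix A = placeGate (signPlacementH e) hGate := rfl
/-- Matrix of a placed `Z` gate of `hSign`. [folklore] -/
theorem toMatrix_sign_Z (A : Language Bool) (e : Fin (hSign.arity HSignOp.Z) ↪ Fin n) :
    (QGate.gate HSignOp.Z e : QGate hSign n).toMatrix A = placeGate (signPlacementZ e) pauliZ := rfl
/-- Matrix of a placed `CZ` gate of `hSign`. [folklore] -/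
theorem toMatrix_sign_CZ (A : Language Bool) (e : Fin (hSign.arity HSignOp.CZ) ↪ Fin n) :
    (QGate.gate HSignOp.CZ e : QGate hSign n).toMatrix A = placeGate (signPlacementCZ e) cz := rfl
/-- Matrix of a placed `CCZ` gate of `hSign`. [folklore] -/
theorem toMatrix_sign_CCZ (A : Language Bool) (e : Fin (hSign.arity HSignOp.CCZ) ↪ Fin n) :
    (QGate.gate HSignOp.CCZ e : QGate hSign n).toMatrix A = placeGate (signPlacementCCZ e) ccsign := rfl

/-- **The block of shapes simulating one gate**: a Hadamard on `a` becomes the triple of gadgets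
on `a` and the two dummies; `Z`, `CZ`, `CCZ` become one phase function between two separators;
oracle gates (outside the promise) the identity block.
[cite: AaronsonAmbainis2018, §6 (proof of Thm. 25)] -/
def blockS : QGate hSign n → List (SignShape (n + 2))
  | .gate HSignOp.H e => tripleS (realEmb n (signPlacementH e 0)) (dum₁ n) (dum₂ n)
  | .gate HSignOp.Z e => [.none, .one (realEmb n (signPlacementZ e 0)), .none]
  | .gate HSignOp.CZ e => [.none, .two (realEmb n (signPlacementCZ e 0)) (realEmb n (signPlacementCZ e 1)), .none]
  | .gate HSignOp.CCZ e =>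
      [.none, .three (realEmb n (signPlacementCCZ e 0)) (realEmb n (signPlacementCCZ e 1))
        (realEmb n (signPlacementCCZ e 2)), .none]
  | .oracle _ _ => [.none]

/-- The blocks of a gate list, each followed by a separator (head = first gate applied).
[cite: AaronsonAmbainis2018, §6 (proof of Thm. 25: "we insert an fᵢ = 1 in between them")] -/
def coreS : List (QGate hSign n) → List (SignShape (n + 2))
  | [] => []
  | g :: gs => blockS g ++ .none :: coreS gs

/-- **The translation of a gate list**: its blocks and a final separator (so that the empty
circuit is `[1]`, the identity). [cite: AaronsonAmbainis2018, §6 (proof of Thm. 25)] -/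
def buildS (gs : List (QGate hSign n)) : List (SignShape (n + 2)) :=
  coreS gs ++ [.none]

/-- The number of Hadamard gates of a gate list over the sign basis. [cite: AaronsonAmbainis2018, §6 (proof of Thm. 25)] -/
def hadamardCountS : List (QGate hSign n) → ℕ
  | [] => 0
  | .gate HSignOp.H _ :: gs => hadamardCountS gs + 1
  | .gate HSignOp.Z _ :: gs => hadamardCountS gs
  | .gate HSignOp.CZ _ :: gs => hadamardCountS gs
  | .gate HSignOp.CCZ _ :: gs => hadamardCountS gs
  | .oracle _ _ :: gs => hadamardCountS gs

/-- A block has at most eleven functions. [folklore] -/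
theorem length_blockS_le (g : QGate hSign n) : (blockS g).length ≤ 11 := by
  rcases g with ⟨_ | _ | _ | _, e⟩ | ⟨m, e⟩ <;> simp [blockS]

/-- The blocks of `m` gates have at most `12 m` functions. [cite: AaronsonAmbainis2018, §6 (Thm. 25: "k = O(m)")] -/
theorem length_coreS_le (gs : List (QGate hSign n)) : (coreS gs).length ≤ 12 * gs.length := by
  induction gs with
  | nil => simp [coreS]
  | cons g gs ih =>
    have := length_blockS_le g
    simp only [coreS, List.length_append, List.length_cons]
    omega

/-- The translation of `m` gates has at most `12 m + 1` functions. [cite: AaronsonAmbainis2018, §6 (Thm. 25: "k = O(m)")] -/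
theorem length_buildS_le (gs : List (QGate hSign n)) : (buildS gs).length ≤ 12 * gs.length + 1 := by
  have := length_coreS_le gs
  simp only [buildS, List.length_append, List.length_singleton]
  omega

/-- The number of Hadamard gates is at most the number of gates. [folklore] -/
theorem hadamardCountS_le_length (gs : List (QGate hSign n)) : hadamardCountS gs ≤ gs.length := by
  induction gs with
  | nil => simp [hadamardCountS]
  | cons g gs ih =>
    rcases g with ⟨_ | _ | _ | _, e⟩ | ⟨m, e⟩ <;>
      · simp only [hadamardCountS, List.length_cons]; omega

/-- The number of Hadamard gates is additive. [folklore] -/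
theorem hadamardCountS_append (gs gs' : List (QGate hSign n)) :
    hadamardCountS (gs ++ gs') = hadamardCountS gs + hadamardCountS gs' := by
  induction gs with
  | nil => simp [hadamardCountS]
  | cons g gs ih =>
    rcases g with ⟨_ | _ | _ | _, e⟩ | ⟨m, e⟩ <;> simp only [List.cons_append, hadamardCountS, ih]
    ring

/-- `buildS` of a nonempty list, unfolded. [folklore] -/
theorem buildS_cons (g : QGate hSign n) (gs : List (QGate hSign n)) :
    buildS (g :: gs) = blockS g ++ .none :: buildS gs := by
  simp [buildS, coreS]

/-- **Blocks compose like circuits**: `F(core gs ++ L) = F(L) · F(build gs)`.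
[cite: AaronsonAmbainis2018, §6 (proof of Thm. 25)] -/
theorem shapeCircuit_coreS_append (gs : List (QGate hSign n)) (L : List (SignShape (n + 2))) :
    shapeCircuit (coreS gs ++ L) = shapeCircuit L * shapeCircuit (buildS gs) := by
  induction gs generalizing L with
  | nil => simp [coreS, buildS]
  | cons g gs ih =>
    rw [coreS, List.append_assoc, List.cons_append, shapeCircuit_append_sep, ih, buildS_cons,
      shapeCircuit_append_sep, mul_assoc]

/-! ### Phase functions of the sign gates as placed gates -/

/-- The phase layer of `z_{E 0}` is the placed `Z` gate. [cite: AaronsonAmbainis2018, §6 Thm. 25] -/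
theorem phaseLayer_one_eq_placeGate (E : Fin 1 ↪ Fin N) :
    phaseLayer (fun z : Fin N → Bool => z (E 0)) = placeGate E pauliZ := by
  rw [pauliZ_eq_diagonal, placeGate_diagonal, phaseLayer]
  congr 1
  funext x
  simp only [Function.comp_apply, signOf]
  split_ifs <;> simp

/-- The phase layer of `z_{E 0} z_{E 1}` is the placed `CZ` gate. [cite: AaronsonAmbainis2018, §6 Thm. 25] -/
theorem phaseLayer_two_eq_placeGate (E : Fin 2 ↪ Fin N) :
    phaseLayer (csignFun (E 0) (E 1)) = placeGate E cz := by
  rw [cz_eq_diagonal, placeGate_diagonal, phaseLayer]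
  congr 1
  funext x
  simp only [Function.comp_apply, signOf, csignFun, Bool.and_eq_true]
  split_ifs <;> simp

/-- The phase layer of `z_{E 0} z_{E 1} z_{E 2}` is the placed `CCZ` gate. [cite: AaronsonAmbainis2018, §6 Thm. 25] -/
theorem phaseLayer_three_eq_placeGate (E : Fin 3 ↪ Fin N) :
    phaseLayer (fun z : Fin N → Bool => z (E 0) && (z (E 1) && z (E 2))) = placeGate E ccsign := by
  rw [ccsign, placeGate_diagonal, phaseLayer]
  congr 1
  funext x
  simp only [Function.comp_apply, signOf, Bool.and_eq_true]
  split_ifs <;> simp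

/-- A one-wire embedding is determined by its value. [folklore] -/
theorem wireEmb_apply_zero (E : Fin 1 ↪ Fin N) : wireEmb (E 0) = E := by
  ext j
  rw [wireEmb_apply, Subsingleton.elim j 0]

/-! ### The invariant -/

/-- One step of the invariant for a gate on the logical wires. [cite: AaronsonAmbainis2018, §6 (proof of Thm. 25)] -/
theorem layout_step_real (M G : Matrix (QReg n) (QReg n) ℂ) (V : Matrix (QReg 2) (QReg 2) ℂ) :
    placeGate (realEmb n) M * placeGate (dumEmb n) V * placeGate (realEmb n) G =
      placeGate (realEmb n) (M * G) * placeGate (dumEmb n) V := by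
  rw [mul_assoc, placeGate_dumEmb_mul_placeGate_realEmb, ← mul_assoc, ← placeGate_mul_holds]

/-- One step of the invariant for a Hadamard gate: the triple contributes `H_a` on the logical
wires and `D` on the dummies. [cite: AaronsonAmbainis2018, §6 (proof of Thm. 25)] -/
theorem layout_step_hadamard (M : Matrix (QReg n) (QReg n) ℂ) (j : ℕ) (a : Fin n) :
    placeGate (realEmb n) M * placeGate (dumEmb n) (dMat ^ j) *
        (hadamardAt (realEmb n a) * placeGate (dumEmb n) dMat) =
      placeGate (realEmb n) (M * hadamardAt a) * placeGate (dumEmb n) (dMat ^ (j + 1)) := by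
  rw [← placeGate_hadamardAt (realEmb n) a, ← mul_assoc, layout_step_real, mul_assoc, ← placeGate_mul_holds,
    pow_succ]

/-- **The invariant of the translation (Thm. 25 without bookkeeping).** For an oracle-free gate
list `gs` on `n` qubits, the Fig. 2 circuit of `buildS gs` on `n + 2` wires is `U_{gs}` on the
logical wires times `D^h` on the two dummies, `h` the number of Hadamard gates.
[cite: AaronsonAmbainis2018, §6 (proof of Thm. 25, pp. 26–27)] -/
theorem shapeCircuit_buildS (gs : List (QGate hSign n)) (hgs : ∀ g ∈ gs, g.IsOracleFree) :
    shapeCircuit (buildS gs) =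
      placeGate (realEmb n) ((⟨gs⟩ : QCircuit hSign n).toMatrix 0) *
        placeGate (dumEmb n) (dMat ^ hadamardCountS gs) := by
  induction gs with
  | nil => simp [buildS, coreS, hadamardCountS]
  | cons g gs ih =>
    have hg : g.IsOracleFree := hgs g (by simp)
    have ih' := ih fun g' h => hgs g' (by simp [h])
    rw [buildS_cons, shapeCircuit_append_sep, ih', QCircuit.toMatrix_cons]
    rcases g with ⟨_ | _ | _ | _, e⟩ | ⟨m, e⟩
    · rw [blockS, shapeCircuit_tripleS (realEmb_ne_dum₁ _) (realEmb_ne_dum₂ _) dum₁_ne_dum₂, hadamardCountS,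
        toMatrix_sign_H, ← wireEmb_apply_zero (signPlacementH e)]
      exact layout_step_hadamard _ _ _
    · rw [blockS, shapeCircuit_phase_block, SignShape.toFun, hadamardCountS, toMatrix_sign_Z,
        show (fun z : Fin (n + 2) → Bool => z (realEmb n (signPlacementZ e 0))) =
          fun z => z (((signPlacementZ e).trans (realEmb n)) 0) from rfl,
        phaseLayer_one_eq_placeGate, ← placeGate_placeGate, layout_step_real]
    · rw [blockS, shapeCircuit_phase_block, SignShape.toFun, hadamardCountS, toMatrix_sign_CZ,
        show csignFun (realEmb n (signPlacementCZ e 0)) (realEmb n (signPlacementCZ e 1)) =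
          csignFun (((signPlacementCZ e).trans (realEmb n)) 0) (((signPlacementCZ e).trans (realEmb n)) 1) from rfl,
        phaseLayer_two_eq_placeGate, ← placeGate_placeGate, layout_step_real]
    · rw [blockS, shapeCircuit_phase_block, SignShape.toFun, hadamardCountS, toMatrix_sign_CCZ,
        show (fun z : Fin (n + 2) → Bool => z (realEmb n (signPlacementCCZ e 0)) &&
            (z (realEmb n (signPlacementCCZ e 1)) && z (realEmb n (signPlacementCCZ e 2)))) =
          fun z => z (((signPlacementCCZ e).trans (realEmb n)) 0) &&
            (z (((signPlacementCCZ e).trans (realEmb n)) 1) && z (((signPlacementCCZ e).trans (realEmb n)) 2)) from rfl,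
        phaseLayer_three_eq_placeGate, ← placeGate_placeGate, layout_step_real]
    · exact absurd hg id

/-! ### Reading off the amplitude -/

/-- If the Fig. 2 circuit of `L` is `M` on the logical wires times `V` on the dummies, its
`⟨0|·|0⟩` entry is `⟨0|M|0⟩ · ⟨00|V|00⟩`. [cite: NielsenChuang2010, §4.2] -/
theorem apply_zero_zero_of_layout {L : List (SignShape (n + 2))} {M : Matrix (QReg n) (QReg n) ℂ}
    {V : Matrix (QReg 2) (QReg 2) ℂ} (hL : shapeCircuit L = placeGate (realEmb n) M * placeGate (dumEmb n) V) :
    shapeCircuit L (fun _ => false) (fun _ => false) =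
      M (fun _ => false) (fun _ => false) * V (fun _ => false) (fun _ => false) := by
  rw [hL, placeGate_mul_placeGate_apply_of_disjoint _ _ disjoint_range_realEmb_dumEmb, if_pos fun _ _ _ => rfl]
  rfl

/-- The finishing step: when the dummies carry `D^j` with `j ≡ 2 (mod 4)`, append one more gadget
`G(d₁, d₂)`; when `4 ∣ j`, nothing. [cite: AaronsonAmbainis2018, §6 (proof of Thm. 25)] -/
def finishS (j : ℕ) (L : List (SignShape (n + 2))) : List (SignShape (n + 2)) :=
  if j % 4 = 0 then L else L ++ .none :: gadgetS (dum₁ n) (dum₂ n)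

/-- The finishing step adds at most four functions. [folklore] -/
theorem length_finishS_le (j : ℕ) (L : List (SignShape (n + 2))) : (finishS j L).length ≤ L.length + 4 := by
  unfold finishS
  split_ifs <;> simp [gadgetS]

/-- **`⟨0|F|0⟩ = ⟨0|M|0⟩` after finishing**, for an even exponent `j`: `⟨00|D^j|00⟩ = 1` if
`4 ∣ j`, and `SWAP H^{⊗2} D^j = SWAP` with `⟨00|SWAP|00⟩ = 1` if `j ≡ 2 (mod 4)`.
[cite: AaronsonAmbainis2018, §6 (proof of Thm. 25)] -/
theorem apply_zero_zero_finishS {L : List (SignShape (n + 2))} {M : Matrix (QReg n) (QReg n) ℂ} {j : ℕ}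
    (hL : shapeCircuit L = placeGate (realEmb n) M * placeGate (dumEmb n) (dMat ^ j)) (hj : j % 2 = 0) :
    shapeCircuit (finishS j L) (fun _ => false) (fun _ => false) = M (fun _ => false) (fun _ => false) := by
  unfold finishS
  split_ifs with h4
  · rw [apply_zero_zero_of_layout hL, dMat_pow_apply_zero_zero h4, mul_one]
  · have h2 : j % 4 = 2 := by omega
    have hL' : shapeCircuit (L ++ .none :: gadgetS (dum₁ n) (dum₂ n)) =
        placeGate (realEmb n) M * placeGate (dumEmb n) swapLayer := by
      rw [shapeCircuit_append_sep, shapeCircuit_gadgetS _ _ dum₁_ne_dum₂, hL, ← mul_assoc, ← dumEmb,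
        placeGate_dumEmb_mul_placeGate_realEmb, mul_assoc, ← placeGate_mul_holds,
        swapLayer_mul_hGateAll_mul_dMat_pow h2]
    rw [apply_zero_zero_of_layout hL', swapLayer_apply_zero_zero, mul_one]

/-! ### The odd case: a bare layer and the un-Hadamard triples -/

/-- The Hadamard gate of the sign basis on the logical qubit `a`. [cite: AaronsonAmbainis2018, §6] -/
def hSignHOn (a : Fin n) : QGate hSign n :=
  QGate.gate HSignOp.H (wireEmb a)

/-- One Hadamard gate on every logical qubit. [cite: AaronsonAmbainis2018, §6 (proof of Thm. 25)] -/
def hOnAllWiresS (n : ℕ) : List (QGate hSign n) :=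
  (List.finRange n).map hSignHOn

/-- The padding gates are oracle-free. [folklore] -/
theorem isOracleFree_of_mem_hOnAllWiresS {g : QGate hSign n} (hg : g ∈ hOnAllWiresS n) : g.IsOracleFree := by
  obtain ⟨a, -, rfl⟩ := List.mem_map.1 hg
  trivial

/-- The padding has `n` Hadamard gates. [folklore] -/
theorem hadamardCountS_hOnAllWiresS (n : ℕ) : hadamardCountS (hOnAllWiresS n) = n := by
  unfold hOnAllWiresS
  suffices h : ∀ ws : List (Fin n), hadamardCountS (ws.map hSignHOn) = ws.length by
    rw [h, List.length_finRange]
  intro ws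
  induction ws with
  | nil => rfl
  | cons a ws ih => rw [List.map_cons, hSignHOn, List.length_cons, ← ih]; rfl

/-- The padding has `n` gates. [folklore] -/
@[simp] theorem length_hOnAllWiresS (n : ℕ) : (hOnAllWiresS n).length = n := by
  simp [hOnAllWiresS]

/-- The sign-basis and the `{H, CCSIGN}` Hadamard paddings have the same matrix (gate by gate).
[folklore] -/
theorem toMatrix_map_hSignHOn (ws : List (Fin n)) :
    (⟨ws.map hSignHOn⟩ : QCircuit hSign n).toMatrix 0 = (⟨ws.map hCCSignHOn⟩ : QCircuit hCCSign n).toMatrix 0 := by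
  induction ws with
  | nil => simp
  | cons a ws ih =>
    have ih' : (⟨ws.map hSignHOn⟩ : QCircuit hSign n).toMatrix 0 = (⟨ws.map hCCSignHOn⟩ : QCircuit hCCSign n).toMatrix 0 := ih
    change (⟨hSignHOn a :: ws.map hSignHOn⟩ : QCircuit hSign n).toMatrix 0 =
      (⟨hCCSignHOn a :: ws.map hCCSignHOn⟩ : QCircuit hCCSign n).toMatrix 0
    rw [QCircuit.toMatrix_cons, QCircuit.toMatrix_cons, ih']
    rfl

/-- **One Hadamard gate on every qubit is `H^{⊗n}`** (sign basis). [cite: NielsenChuang2010, §1.4.4 eq. (1.50)] -/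
theorem toMatrix_hOnAllWiresS (n : ℕ) : (⟨hOnAllWiresS n⟩ : QCircuit hSign n).toMatrix 0 = hGateAll n := by
  rw [hOnAllWiresS, toMatrix_map_hSignHOn, ← hOnAllWires, toMatrix_hOnAllWires]

/-- **The odd-case translation**: the blocks of `gs`, a bare layer `H^{⊗(n+2)}` (two consecutive
separators), and the translation of one Hadamard gate on every logical qubit (undoing the bare
layer there). [cite: AaronsonAmbainis2018, §6 (proof of Thm. 25)] -/
def oddS (gs : List (QGate hSign n)) : List (SignShape (n + 2)) :=
  coreS gs ++ .none :: buildS (hOnAllWiresS n)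

/-- The odd-case translation has at most `12(m + n) + 2` functions. [cite: AaronsonAmbainis2018, §6 (Thm. 25)] -/
theorem length_oddS_le (gs : List (QGate hSign n)) : (oddS gs).length ≤ 12 * (gs.length + n) + 2 := by
  have h1 := length_coreS_le gs
  have h2 := length_buildS_le (hOnAllWiresS n)
  simp only [oddS, List.length_append, List.length_cons, length_hOnAllWiresS] at h2 ⊢
  omega

/-- **The odd case lands in the same layout with exponent `n + 2 + h`**: the bare layer is
`H^{⊗n} ⊗ H^{⊗2} = H^{⊗n} ⊗ D²`, the padding contributes `H^{⊗n} ⊗ D^n`, and `H^{⊗n} H^{⊗n} = 1`.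
[cite: AaronsonAmbainis2018, §6 (proof of Thm. 25)] -/
theorem shapeCircuit_oddS (gs : List (QGate hSign n)) (hgs : ∀ g ∈ gs, g.IsOracleFree) :
    shapeCircuit (oddS gs) =
      placeGate (realEmb n) ((⟨gs⟩ : QCircuit hSign n).toMatrix 0) *
        placeGate (dumEmb n) (dMat ^ (n + 2 + hadamardCountS gs)) := by
  rw [oddS, shapeCircuit_coreS_append, shapeCircuit_sep_cons,
    shapeCircuit_buildS _ (fun g hg => isOracleFree_of_mem_hOnAllWiresS hg), toMatrix_hOnAllWiresS,
    hadamardCountS_hOnAllWiresS, shapeCircuit_buildS gs hgs, hGateAll_layout, ← dMat_mul_dMat, ← pow_two]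
  -- `P_R(Hⁿ) P_D(Dⁿ) · P_R(Hⁿ) P_D(D²) · P_R(M) P_D(D^h)`, left-associated
  simp only [← mul_assoc]
  rw [layout_step_real, hGateAll_mul_self, placeGate_one, one_mul, ← placeGate_mul_holds,
    placeGate_dumEmb_mul_placeGate_realEmb, mul_assoc, ← placeGate_mul_holds, ← pow_add, ← pow_add]

/-! ### Idle wires over the sign basis -/

/-- Idle wires do not change the number of Hadamard gates. [folklore] -/
theorem hadamardCountS_map_liftGateSucc (gs : List (QGate hSign n)) :
    hadamardCountS (gs.map liftGateSucc) = hadamardCountS gs := by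
  induction gs with
  | nil => rfl
  | cons g gs ih =>
    rcases g with ⟨_ | _ | _ | _, e⟩ | ⟨m, e⟩ <;> simp only [List.map_cons, liftGateSucc, hadamardCountS, ih]

/-- Idle wires do not change the number of Hadamard gates. [folklore] -/
theorem hadamardCountS_liftCircuitBy (t : ℕ) (Q : QCircuit hSign n) :
    hadamardCountS (liftCircuitBy t Q).gates = hadamardCountS Q.gates := by
  induction t with
  | zero => rfl
  | succ t ih => rw [liftCircuitBy, liftCircuitSucc, hadamardCountS_map_liftGateSucc, ih]

/-- An idle wire does not change the transition amplitude. [cite: AaronsonAmbainis2018, §6] -/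
theorem signAmplitude_liftCircuitSucc (Q : QCircuit hSign n) :
    signAmplitude (liftCircuitSucc Q) = signAmplitude Q := by
  unfold signAmplitude QCircuit.mat
  rw [toMatrix_liftCircuitSucc, placeGate_apply, if_pos fun _ _ => rfl]
  rfl

/-- Idle wires do not change the transition amplitude. [cite: AaronsonAmbainis2018, §6] -/
theorem signAmplitude_liftCircuitBy (t : ℕ) (Q : QCircuit hSign n) :
    signAmplitude (liftCircuitBy t Q) = signAmplitude Q := by
  induction t with
  | zero => rfl
  | succ t ih => rw [liftCircuitBy, signAmplitude_liftCircuitSucc, ih]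

/-! ### The produced shapes and `Φ = A_Q` -/

/-- The number of idle logical wires added by the reduction: one iff `n` is even, so that the
number `n' = n + padCount n` of logical wires is always odd (an odd number of Hadamard gates needs
an odd number of logical wires; making the layout independent of the gates lets a one-pass machine
know the dummy wires `n'`, `n' + 1` before reading the gate list).
[cite: AaronsonAmbainis2018, §6 (proof of Thm. 25)] -/
def padCount (n : ℕ) : ℕ :=
  (n + 1) % 2

/-- At most one idle wire is added. [folklore] -/
theorem padCount_le_one (n : ℕ) : padCount n ≤ 1 := by
  unfold padCount; omega

/-- After padding the number of logical wires is odd. [folklore] -/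
theorem padCount_spec (n : ℕ) : (n + padCount n) % 2 = 1 := by
  unfold padCount; omega

/-- **The shapes produced by the reduction** for an `n`-qubit circuit `Q` over the sign basis, on
`N = n' + 2` bits, `n' = n + padCount n` odd: the translation of the (lifted) circuit finished
according to `h mod 4` if the number `h` of Hadamard gates is even, and the odd-case translation
(bare layer and un-Hadamard triples) finished according to `(n' + 2 + h) mod 4` otherwise.
[cite: AaronsonAmbainis2018, §6 (proof of Thm. 25)] -/
def thm25SignShapes (n : ℕ) (Q : QCircuit hSign n) : List (SignShape (n + padCount n + 2)) :=
  if hadamardCountS Q.gates % 2 = 0 then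
    finishS (hadamardCountS Q.gates) (buildS (liftCircuitBy (padCount n) Q).gates)
  else
    finishS (n + padCount n + 2 + hadamardCountS Q.gates) (oddS (liftCircuitBy (padCount n) Q).gates)

/-- The reduction uses at most `n + 3` bits. [cite: AaronsonAmbainis2018, §6 Thm. 25] -/
theorem thm25Sign_bits_le (n : ℕ) : n + padCount n + 2 ≤ n + 3 := by
  have := padCount_le_one n; omega

/-- The reduction produces at most `12(m + n + 1) + 6` functions.
[cite: AaronsonAmbainis2018, §6 Thm. 25 ("k = O(m)"; here O(m + n))] -/
theorem length_thm25SignShapes_le (n : ℕ) (Q : QCircuit hSign n) :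
    (thm25SignShapes n Q).length ≤ 12 * (Q.size + n + 1) + 6 := by
  have hpad := padCount_le_one n
  unfold thm25SignShapes
  split_ifs
  · refine (length_finishS_le _ _).trans ?_
    have h := length_buildS_le (liftCircuitBy (padCount n) Q).gates
    have hs : (liftCircuitBy (padCount n) Q).gates.length = Q.size := size_liftCircuitBy _ Q
    rw [hs] at h
    nlinarith
  · refine (length_finishS_le _ _).trans ?_
    have h := length_oddS_le (liftCircuitBy (padCount n) Q).gates
    have hs : (liftCircuitBy (padCount n) Q).gates.length = Q.size := size_liftCircuitBy _ Q
    rw [hs] at h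
    nlinarith

/-- **Every produced function is `1`, `(-1)^{z_a}`, `(-1)^{z_a z_b}` or `(-1)^{z_a z_b z_c}`**
(the "Moreover" clause of Thm. 25). [cite: AaronsonAmbainis2018, §6 Thm. 25 ("Moreover")] -/
theorem isFewBitProduct_of_mem_thm25SignShapes (n : ℕ) (Q : QCircuit hSign n) :
    ∀ s ∈ thm25SignShapes n Q, IsFewBitProduct s.toFun :=
  fun s _ => s.isFewBitProduct_toFun

/-- **The produced functions have `Φ = A_Q`**: the `⟨0…0|·|0…0⟩` entry of the Fig. 2 circuit of
the produced functions is `A_Q`, in both parity cases. [cite: AaronsonAmbainis2018, §6 (proof of Thm. 25: "such that Φ_{f₁,…,f_k} = A_Q")] -/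
theorem shapeCircuit_thm25SignShapes_apply_zero_zero (n : ℕ) (Q : QCircuit hSign n) (hQ : Q.IsOracleFree) :
    shapeCircuit (thm25SignShapes n Q) (fun _ => false) (fun _ => false) = (signAmplitude Q : ℂ) := by
  rw [← signAmplitude_liftCircuitBy (padCount n) Q, signAmplitude_coe]
  have hfree := isOracleFree_liftCircuitBy (padCount n) hQ
  have hcount := hadamardCountS_liftCircuitBy (padCount n) Q
  unfold thm25SignShapes
  split_ifs with h
  · refine apply_zero_zero_finishS ?_ h
    rw [shapeCircuit_buildS _ hfree, hcount]
  · refine apply_zero_zero_finishS ?_ ?_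
    · rw [shapeCircuit_oddS _ hfree, hcount]
    · have := padCount_spec n
      omega

/-- **AA Thm. 25, amplitude form, over the sign basis (no bookkeeping).** For every oracle-free
`n`-qubit circuit `Q` over `{H, Z, CZ, CCZ}` with `m` gates there are `k ≤ 12(m + n + 1) + 6`
Boolean functions on `N ≤ n + 3` bits, each `1` or a product of at most three input bits, whose
`k`-fold forrelation is exactly `A_Q = ⟨0ⁿ|Q|0ⁿ⟩`.
[cite: AaronsonAmbainis2018, §6 Thm. 25 and its proof (pp. 26–27)] -/
theorem AaronsonAmbainis2018_thm25_sign_amplitude (n : ℕ) (Q : QCircuit hSign n) (hQ : Q.IsOracleFree) :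
    ∃ (N k : ℕ) (f : Fin k → (Fin N → Bool) → Bool), N ≤ n + 3 ∧ k ≤ 12 * (Q.size + n + 1) + 6 ∧
      (∀ i, IsFewBitProduct (f i)) ∧ kForrelationValue f = signAmplitude Q := by
  refine ⟨n + padCount n + 2, (thm25SignShapes n Q).length,
    fun i => ((thm25SignShapes n Q).get i).toFun, thm25Sign_bits_le _, length_thm25SignShapes_le n Q,
    fun i => SignShape.isFewBitProduct_toFun _, ?_⟩
  apply Complex.ofReal_injective
  rw [← forrelationCircuit_apply_zero_zero, forrelationCircuit_eq_forrelationCircuitL, ofFn_get_comp]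
  exact shapeCircuit_thm25SignShapes_apply_zero_zero n Q hQ

/-! ### The instance map and its correctness -/

open scoped Classical in
/-- **The instance map of Theorem 25 over the sign basis**: an oracle-free instance `(n, Q)` is
sent to the explicit FORRELATION instance `(N, k, C₁, …, C_k)` with `Cᵢ` the `B₂`-circuit of the
`i`-th produced shape; instances outside the promise (oracle gates) go to the empty instance.
[cite: AaronsonAmbainis2018, §6 Thm. 25 (proof)] -/
def thm25SignInstance (I : QSimSignInstance) : KForrelationInstance :=
  if I.circuit.IsOracleFree then
    { n := I.n + padCount I.n + 2
      k := (thm25SignShapes I.n I.circuit).length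
      C := fun i => ((thm25SignShapes I.n I.circuit).get i).toCircuit }
  else KForrelationInstance.empty

/-- The instance map on oracle-free instances (the `if` resolved). [cite: AaronsonAmbainis2018, §6 Thm. 25] -/
theorem thm25SignInstance_of_isOracleFree (I : QSimSignInstance) (hI : I.circuit.IsOracleFree) :
    thm25SignInstance I =
      { n := I.n + padCount I.n + 2
        k := (thm25SignShapes I.n I.circuit).length
        C := fun i => ((thm25SignShapes I.n I.circuit).get i).toCircuit } := by
  rw [thm25SignInstance, if_pos hI]

/-- The produced circuits are over `B₂`. [cite: AaronsonAmbainis2018, §6 Thm. 25] -/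
theorem isOverB2_thm25SignInstance (I : QSimSignInstance) : (thm25SignInstance I).IsOverB2 := by
  unfold thm25SignInstance
  split_ifs
  · exact fun _ => SignShape.toCircuit_isOver_B2 _
  · exact fun i => i.elim0

/-- The produced instance has at most `n + 3` input bits. [cite: AaronsonAmbainis2018, §6 Thm. 25] -/
theorem n_thm25SignInstance_le (I : QSimSignInstance) : (thm25SignInstance I).n ≤ I.n + 3 := by
  unfold thm25SignInstance
  split_ifs
  · exact thm25Sign_bits_le _
  · exact Nat.zero_le _

/-- The produced instance has at most `12(m + n + 1) + 6` circuits. [cite: AaronsonAmbainis2018, §6 Thm. 25 ("k = O(m)")] -/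
theorem k_thm25SignInstance_le (I : QSimSignInstance) :
    (thm25SignInstance I).k ≤ 12 * (I.circuit.size + I.n + 1) + 6 := by
  unfold thm25SignInstance
  split_ifs
  · exact length_thm25SignShapes_le _ _
  · exact Nat.zero_le _

/-- Each produced circuit has at most two gates. [cite: AaronsonAmbainis2018, §6 Thm. 25] -/
theorem size_C_thm25SignInstance_le (I : QSimSignInstance) :
    ∀ i : Fin (thm25SignInstance I).k, ((thm25SignInstance I).C i).size ≤ 2 := by
  by_cases h : I.circuit.IsOracleFree
  · rw [thm25SignInstance_of_isOracleFree I h]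
    exact fun _ => SignShape.size_toCircuit_le _
  · rw [thm25SignInstance, if_neg h]
    exact fun i => i.elim0

/-- **Correctness of the instance map: `Φ(thm25SignInstance I) = A_Q`.**
[cite: AaronsonAmbainis2018, §6 Thm. 25 (proof: "such that Φ_{f₁,…,f_k} = A_Q")] -/
theorem value_thm25SignInstance (I : QSimSignInstance) (hI : I.circuit.IsOracleFree) :
    (thm25SignInstance I).value = I.amplitude := by
  rw [thm25SignInstance_of_isOracleFree I hI]
  apply Complex.ofReal_injective
  unfold KForrelationInstance.value QSimSignInstance.amplitude
  simp only [SignShape.eval_toCircuit_eq]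
  rw [← forrelationCircuit_apply_zero_zero, forrelationCircuit_eq_forrelationCircuitL, ofFn_get_comp]
  exact shapeCircuit_thm25SignShapes_apply_zero_zero I.n I.circuit hI

/-- Yes-instances go to yes-instances (same threshold `3/5`). [cite: AaronsonAmbainis2018, §6 Thm. 25] -/
theorem isYes_thm25SignInstance {I : QSimSignInstance} (h : I.IsYes) : (thm25SignInstance I).IsYes :=
  ⟨isOverB2_thm25SignInstance I, by rw [value_thm25SignInstance I h.1]; exact h.2⟩

/-- No-instances go to no-instances (same threshold `1/100`). [cite: AaronsonAmbainis2018, §6 Thm. 25] -/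
theorem isNo_thm25SignInstance {I : QSimSignInstance} (h : I.IsNo) : (thm25SignInstance I).IsNo :=
  ⟨isOverB2_thm25SignInstance I, by rw [value_thm25SignInstance I h.1]; exact h.2⟩

/-! ### Assembly: Theorem 25 over the sign basis from the computability of the instance map -/

/-- NAMED FACT (**the residual Turing-machine content of AA Thm. 25 over the sign basis**): the
instance map, on codes — `code(n, Q) ↦ code(thm25SignInstance (n, Q))` (instances encoded by
`QSimSignInstance.encode`, `n` in unary; FORRELATION instances by `KForrelationInstance.encode`)
— is computed by some function in `FP`. The map is a transcription of the gate list with every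
wire index copied verbatim (`blockS`), preceded by one pass counting the Hadamard gates modulo `4`
(and `n` modulo `2`), and followed by the padding blocks and the finishing gadget; its output has
`k ≤ 12(m + n + 1) + 6` circuits (`k_thm25SignInstance_le`) of `≤ 2` gates on `N ≤ n + 3` wires,
`O((m + n) log (n + 3))` bits for an input of length `≥ 2n + 2m`.
[cite: AaronsonAmbainis2018, §6 Thm. 25 (proof, p. 27)] -/
def AaronsonAmbainis2018_thm25_sign_encodeFP : Prop :=
  ∃ f ∈ FP, ∀ I : QSimSignInstance, f I.encode = (thm25SignInstance I).encode

/-- **AA Theorem 25 over the sign basis from its residual `TM2` content**: if the instance map is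
polynomial-time computable on codes, QSIM over `{H, Z, CZ, CCZ}` Karp-reduces to explicit
`k`-fold FORRELATION. [cite: AaronsonAmbainis2018, §6 Thm. 25] -/
theorem AaronsonAmbainis2018_thm25_sign_of_encodeFP (h : AaronsonAmbainis2018_thm25_sign_encodeFP) :
    AaronsonAmbainis2018_thm25_sign := by
  obtain ⟨f, hf, hfI⟩ := h
  refine ⟨f, hf, ?_, ?_⟩
  · rintro w ⟨I, hI, rfl⟩
    rw [hfI]
    exact (encode_mem_kForrelationProblem_yes_iff _).2 (isYes_thm25SignInstance hI)
  · rintro w ⟨I, hI, rfl⟩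
    rw [hfI]
    exact (encode_mem_kForrelationProblem_no_iff _).2 (isNo_thm25SignInstance hI)

/-- **The completeness fact from the residual named facts of the sign route**: membership of
explicit `k`-fold FORRELATION in `PromiseBQP`, `PromiseBQP`-hardness of QSIM over the sign basis
(Lemma 24) and polynomial-time computability of the (here constructed and proved correct) instance
map. [cite: AaronsonAmbainis2018, §6 (Prop. 6, Lemma 24, Thm. 25)] -/
theorem aaronson_ambainis_kForrelation_complete_of_sign_encodeFP
    (hmem : AaronsonAmbainis2018_kForrelation_mem) (h24 : AaronsonAmbainis2018_lemma24_sign_hard)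
    (h25 : AaronsonAmbainis2018_thm25_sign_encodeFP) : aaronson_ambainis_kForrelation_complete :=
  aaronson_ambainis_kForrelation_complete_of_sign_steps hmem h24 (AaronsonAmbainis2018_thm25_sign_of_encodeFP h25)

end Literature.Computability.QuantumComplexity

end
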